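import Summits.ResolutionOfSingularities.ResolutionOfSingularities.Theorems.EquisingularLiftEquisingularLiftNatVertexRibbonExit
import HarnessLib

/-!
# [OURS · L1 W4.5(b) · EL♮] K-VERTEX-EXIT, RIBBON SIDE (chart `x₁`, and both charts): `Bl_{(x̄₃,x̄₁)} 𝒞` — the second small
# resolution of the K5-vertex, induced by the ribbon centres `Z_m` — is regular on every chart
# (crux `EquisingularLiftNat` = stmt-ResolutionOfSingularities-20038; K-∀n / K5-BMY lane, kill test #50)

HONEST FRAMING. OURS (cell res-hironaka, crux chain w45b, slot W4.5(b)); NOT a statement of any manuscript; replaces the role of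
NOTHING in the manuscript; AI-written, AI review is weaker than expert review. Helper `--supports stmt-ResolutionOfSingularities-20038
--as helper`. Sequel of `…NatVertexExitChartC` (p547268: `𝒪_𝒞`, `I₂(N)`) and `…NatVertexRibbonExit` (ribbon centres `Z_m`, trace `tr₁ = (x̄₃, x̄₁)`,
chart `x₃`); object = res-L1-w45b-strat-1 STRATEGY-CENSUS v11 (sha16 6d78683fc4832623) §4 N6.1 (c) «chart z₁ = z₂s: St(𝒞) = V(c + y₂s, y₁ − sd);
both regular», model form.

THE THEOREM: `ψ₁' : k[x₁, y₂, d, s] → 𝒪_𝒞[(x̄₃, x̄₁)/x̄₁]`, `s ↦ x̄₃/x̄₁`, is a BIJECTION for `k` a domain (`ψ₁'_bijective`), with graph relations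
`c̄ = −ȳ₂·s`, `ȳ₁ = d̄·s` (`algebraMap_c_eq₁'`, `algebraMap_y₁_eq₁'`); for a field the chart is regular (`isRegularRing_B₁'`) and so is EVERY chart of
`Bl_{(x̄₃,x̄₁)} 𝒞` (`isRegularRing_ribbonChart`). With `…NatVertexExitChartY2` (`isRegularRing_chart`): BOTH small resolutions of the vertex —
the Σ-touch (reduced fibre, column 2) and the ribbon touches `Z_m` (fibre `m·Σ_{L₁}`, column 1) — regularise `St(𝒞)` over `v_P` at model level.
Model coordinates `X 0,…,X 3 = x₁, y₂, d, s`.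

References: res-L1-w45b-strat-1 STRATEGY-CENSUS v11 N6.1 (c); [StacksProject, Tags 052P/052Q/080E]; [GortzWedhorn2020, (13.19) p. 415].
-/

set_option linter.dupNamespace false -- mandated namespace `Summit.<Summit>.<Problem>` of this single-conjunct summit

noncomputable section

universe u

open Literature.AlgebraicGeometry.Resolution MvPolynomial

namespace Summit.ResolutionOfSingularities.ResolutionOfSingularities.Cruxes.EquisingularLiftNat.Sections

namespace VertexExit

variable (k : Type u) [CommRing k]

/-! ## Chart `x₁` of `Bl_{(x̄₃, x̄₁)} 𝒞`: `≅ k[x₁, y₂, d, s]`, `s = x̄₃/x̄₁`, graph `c̄ = −ȳ₂s`, `ȳ₁ = d̄s`; both ribbon charts regular -/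

/-- The chart `B₁' = 𝒪_𝒞[(x̄₃, x̄₁)/x̄₁]`. OURS bookkeeping. -/
abbrev B₁' : Subalgebra (OC k) (Localization.Away (tr₁ k 1)) := blowupAlgebra (Ideal.span (Set.range (tr₁ k))) (tr₁ k 1)

/-- The values of the model coordinates `x₁, y₂, d, s` in `B₁'`. OURS bookkeeping. -/
def cv₁' : Fin 4 → B₁' k :=
  ![algebraMap (OC k) (B₁' k) (mkC k (X 3)), algebraMap (OC k) (B₁' k) (mkC k (X 4)), algebraMap (OC k) (B₁' k) (mkC k (X 5)),
    blowupAlgebra.frac (tr₁ k) 1 0]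

/-- **`ψ₁' : k[x₁, y₂, d, s] → B₁'`**, `s ↦ x̄₃/x̄₁`. OURS bookkeeping. -/
def ψ₁' : MvPolynomial (Fin 4) k →+* B₁' k :=
  MvPolynomial.eval₂Hom ((algebraMap (OC k) (B₁' k)).comp ((mkC k).comp MvPolynomial.C)) (cv₁' k)

/-- `m₁₂ = 0`: `c̄ x̄₁ = −ȳ₂ x̄₃`. [folklore] -/
theorem c_mul_x₁ : mkC k (X 1) * mkC k (X 3) = -(mkC k (X 4) * mkC k (X 0)) := by
  rw [← map_mul, ← map_mul, ← map_neg, Ideal.Quotient.eq]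
  refine Ideal.subset_span (Or.inl ?_)
  rw [m₁₂]; ring

/-- `m₁₃ = 0`: `ȳ₁ x̄₁ = d̄ x̄₃`. [folklore] -/
theorem y₁_mul_x₁ : mkC k (X 2) * mkC k (X 3) = mkC k (X 5) * mkC k (X 0) := by
  rw [← map_mul, ← map_mul, Ideal.Quotient.eq]
  have h : (X 2 * X 3 - X 5 * X 0 : MvPolynomial (Fin 6) k) = -m₁₃ k := by rw [m₁₃]; ring
  rw [h]
  exact (minors k).neg_mem (Ideal.subset_span (by simp))

/-- `x̄₁ · (1/x̄₁) = 1`. [folklore] -/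
theorem x₁_mul_invSelf :
    algebraMap (OC k) (Localization.Away (tr₁ k 1)) (tr₁ k 1) * IsLocalization.Away.invSelf (tr₁ k 1) = 1 :=
  IsLocalization.Away.mul_invSelf (S := Localization.Away (tr₁ k 1)) (tr₁ k 1)

/-- `ψ₁'` on constants. [folklore] -/
theorem ψ₁'_C (a : k) : ψ₁' k (C a) = algebraMap (OC k) (B₁' k) (mkC k (C a)) := MvPolynomial.eval₂Hom_C _ _ a
/-- `ψ₁' x₁ = x̄₁`. [folklore] -/
theorem ψ₁'_X₀ : ψ₁' k (X 0) = algebraMap (OC k) (B₁' k) (mkC k (X 3)) := MvPolynomial.eval₂Hom_X' _ _ 0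
/-- `ψ₁' y₂ = ȳ₂`. [folklore] -/
theorem ψ₁'_X₁ : ψ₁' k (X 1) = algebraMap (OC k) (B₁' k) (mkC k (X 4)) := MvPolynomial.eval₂Hom_X' _ _ 1
/-- `ψ₁' d = d̄`. [folklore] -/
theorem ψ₁'_X₂ : ψ₁' k (X 2) = algebraMap (OC k) (B₁' k) (mkC k (X 5)) := MvPolynomial.eval₂Hom_X' _ _ 2
/-- `ψ₁' s = x̄₃/x̄₁`. [folklore] -/
theorem ψ₁'_X₃ : ψ₁' k (X 3) = blowupAlgebra.frac (tr₁ k) 1 0 := MvPolynomial.eval₂Hom_X' _ _ 3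

/-- **Graph relation `c̄ = −ȳ₂·s` in `B₁'`** (N6.1 (c) «chart z₁ = z₂s: `St(𝒞) = V(c + y₂s, y₁ − sd)`»). [folklore] -/
theorem algebraMap_c_eq₁' : algebraMap (OC k) (B₁' k) (mkC k (X 1)) = -(ψ₁' k (X 1) * ψ₁' k (X 3)) := by
  rw [ψ₁'_X₁, ψ₁'_X₃]
  apply Subtype.ext
  rw [Subalgebra.coe_neg, Subalgebra.coe_mul, blowupAlgebra.coe_frac]
  refine rel_div _ _ _ _ _ (x₁_mul_invSelf k) ?_
  change algebraMap (OC k) (Localization.Away (tr₁ k 1)) (mkC k (X 1)) * algebraMap (OC k) _ (mkC k (X 3)) =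
    -(algebraMap (OC k) _ (mkC k (X 4)) * algebraMap (OC k) _ (mkC k (X 0)))
  rw [← map_mul (algebraMap (OC k) (Localization.Away (tr₁ k 1))), ← map_mul (algebraMap (OC k) (Localization.Away (tr₁ k 1))),
    ← map_neg (algebraMap (OC k) (Localization.Away (tr₁ k 1))), c_mul_x₁]

/-- **Graph relation `ȳ₁ = d̄·s` in `B₁'`.** [folklore] -/
theorem algebraMap_y₁_eq₁' : algebraMap (OC k) (B₁' k) (mkC k (X 2)) = ψ₁' k (X 2) * ψ₁' k (X 3) := by
  rw [ψ₁'_X₂, ψ₁'_X₃]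
  apply Subtype.ext
  rw [Subalgebra.coe_mul, blowupAlgebra.coe_frac]
  refine rel_div' _ _ _ _ _ (x₁_mul_invSelf k) ?_
  change algebraMap (OC k) (Localization.Away (tr₁ k 1)) (mkC k (X 2)) * algebraMap (OC k) _ (mkC k (X 3)) =
    algebraMap (OC k) _ (mkC k (X 5)) * algebraMap (OC k) _ (mkC k (X 0))
  rw [← map_mul (algebraMap (OC k) (Localization.Away (tr₁ k 1))), ← map_mul (algebraMap (OC k) (Localization.Away (tr₁ k 1))),
    y₁_mul_x₁]

/-- `x̄₃ = x̄₁ · s` in `B₁'`. [folklore] -/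
theorem algebraMap_x₃_eq₁' : algebraMap (OC k) (B₁' k) (mkC k (X 0)) = ψ₁' k (X 0) * ψ₁' k (X 3) := by
  rw [ψ₁'_X₀, ψ₁'_X₃]
  apply Subtype.ext
  rw [Subalgebra.coe_mul, blowupAlgebra.coe_frac]
  exact rel_mul _ _ _ (x₁_mul_invSelf k)

/-- Every `x̄ⱼ` lies in the image of `ψ₁'`. [folklore] -/
theorem algebraMap_X_mem_range₁' (j : Fin 6) : algebraMap (OC k) (B₁' k) (mkC k (X j)) ∈ (ψ₁' k).range := by
  match j with
  | ⟨0, _⟩ =>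
    exact (show algebraMap (OC k) (B₁' k) (mkC k (X 0)) ∈ (ψ₁' k).range from
      ⟨X 0 * X 3, by rw [map_mul, ← algebraMap_x₃_eq₁']⟩)
  | ⟨1, _⟩ =>
    exact (show algebraMap (OC k) (B₁' k) (mkC k (X 1)) ∈ (ψ₁' k).range from
      ⟨-(X 1 * X 3), by rw [map_neg, map_mul, ← algebraMap_c_eq₁']⟩)
  | ⟨2, _⟩ =>
    exact (show algebraMap (OC k) (B₁' k) (mkC k (X 2)) ∈ (ψ₁' k).range from
      ⟨X 2 * X 3, by rw [map_mul, ← algebraMap_y₁_eq₁']⟩)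
  | ⟨3, _⟩ => exact ⟨X 0, ψ₁'_X₀ k⟩
  | ⟨4, _⟩ => exact ⟨X 1, ψ₁'_X₁ k⟩
  | ⟨5, _⟩ => exact ⟨X 2, ψ₁'_X₂ k⟩

/-- Every constant lies in the image of `ψ₁'`. [folklore] -/
theorem algebraMap_mem_range₁' (y : OC k) : algebraMap (OC k) (B₁' k) y ∈ (ψ₁' k).range := by
  obtain ⟨G, rfl⟩ := Ideal.Quotient.mk_surjective y
  induction G using MvPolynomial.induction_on with
  | C a => exact ⟨C a, ψ₁'_C k a⟩
  | add p q hp hq => rw [map_add, map_add]; exact add_mem hp hq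
  | mul_X p j hp => rw [map_mul, map_mul]; exact mul_mem hp (algebraMap_X_mem_range₁' k j)

/-- Every fraction lies in the image of `ψ₁'`. [folklore] -/
theorem frac_mem_range₁' (j : Fin 2) : blowupAlgebra.frac (tr₁ k) 1 j ∈ (ψ₁' k).range := by
  have h1 : blowupAlgebra.frac (tr₁ k) 1 1 ∈ (ψ₁' k).range := by
    refine ⟨1, ?_⟩
    rw [map_one]
    apply Subtype.ext
    rw [blowupAlgebra.coe_frac, OneMemClass.coe_one]
    exact (x₁_mul_invSelf k).symm
  match j with
  | ⟨0, _⟩ => exact ⟨X 3, ψ₁'_X₃ k⟩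
  | ⟨1, _⟩ => exact h1

/-- **`ψ₁'` is onto.** [folklore] -/
theorem ψ₁'_surjective : Function.Surjective (ψ₁' k) := by
  intro z
  obtain ⟨F, rfl⟩ := blowupAlgebra.eval_surjective (tr₁ k) 1 z
  suffices h : (blowupAlgebra.eval (tr₁ k) 1 F) ∈ (ψ₁' k).range by exact h
  induction F using MvPolynomial.induction_on with
  | C y => rw [blowupAlgebra.eval_C]; exact algebraMap_mem_range₁' k y
  | add p q hp hq => rw [map_add]; exact add_mem hp hq
  | mul_X p j hp => rw [map_mul, blowupAlgebra.eval_X]; exact mul_mem hp (frac_mem_range₁' k j.1)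

/-- The inverse substitution `x₃ ↦ x₁s, c ↦ −y₂s, y₁ ↦ ds, x₁ ↦ x₁, y₂ ↦ y₂, d ↦ d`. OURS bookkeeping. -/
def lamVal₁' : Fin 6 → MvPolynomial (Fin 4) k := ![X 0 * X 3, -(X 1 * X 3), X 2 * X 3, X 0, X 1, X 2]

/-- `x₃ ↦ x₁s`. [folklore] -/
theorem lamVal₁'_0 : lamVal₁' k 0 = X 0 * X 3 := rfl
/-- `c ↦ −y₂s`. [folklore] -/
theorem lamVal₁'_1 : lamVal₁' k 1 = -(X 1 * X 3) := rfl
/-- `y₁ ↦ ds`. [folklore] -/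
theorem lamVal₁'_2 : lamVal₁' k 2 = X 2 * X 3 := rfl
/-- `x₁ ↦ x₁`. [folklore] -/
theorem lamVal₁'_3 : lamVal₁' k 3 = X 0 := rfl
/-- `y₂ ↦ y₂`. [folklore] -/
theorem lamVal₁'_4 : lamVal₁' k 4 = X 1 := rfl
/-- `d ↦ d`. [folklore] -/
theorem lamVal₁'_5 : lamVal₁' k 5 = X 2 := rfl

/-- The substitution kills the three minors. [folklore] -/
theorem minors_le_ker₁' : minors k ≤ RingHom.ker (MvPolynomial.eval₂Hom MvPolynomial.C (lamVal₁' k)) := by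
  rw [minors, Ideal.span_le]
  rintro F (rfl | rfl | rfl)
  · rw [SetLike.mem_coe, RingHom.mem_ker, m₁₂]
    simp only [map_add, map_mul, MvPolynomial.eval₂Hom_X', lamVal₁'_0, lamVal₁'_1, lamVal₁'_3, lamVal₁'_4]
    ring
  · rw [SetLike.mem_coe, RingHom.mem_ker, m₁₃]
    simp only [map_sub, map_mul, MvPolynomial.eval₂Hom_X', lamVal₁'_0, lamVal₁'_2, lamVal₁'_3, lamVal₁'_5]
    ring
  · rw [SetLike.mem_coe, RingHom.mem_ker, m₂₃]
    simp only [map_sub, map_neg, map_mul, MvPolynomial.eval₂Hom_X', lamVal₁'_1, lamVal₁'_2, lamVal₁'_4, lamVal₁'_5]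
    ring

/-- `λ₁' : 𝒪_𝒞 → k[x₁,y₂,d,s][1/x₁]`. OURS bookkeeping. -/
def lam₁' : OC k →+* Localization.Away (X 0 : MvPolynomial (Fin 4) k) :=
  Ideal.Quotient.lift (minors k)
    ((algebraMap (MvPolynomial (Fin 4) k) (Localization.Away (X 0 : MvPolynomial (Fin 4) k))).comp
      (MvPolynomial.eval₂Hom MvPolynomial.C (lamVal₁' k)))
    (fun a ha => by rw [RingHom.comp_apply, RingHom.mem_ker.mp (minors_le_ker₁' k ha), map_zero])

/-- `λ₁'` on classes. [folklore] -/
theorem lam₁'_mkC (F : MvPolynomial (Fin 6) k) :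
    lam₁' k (mkC k F) = algebraMap (MvPolynomial (Fin 4) k) (Localization.Away (X 0 : MvPolynomial (Fin 4) k))
      (MvPolynomial.eval₂Hom MvPolynomial.C (lamVal₁' k) F) :=
  Ideal.Quotient.lift_mk _ _ _

/-- `λ₁'(x̄₁) = x₁`. [folklore] -/
theorem lam₁'_tr_one : lam₁' k (tr₁ k 1) =
    algebraMap (MvPolynomial (Fin 4) k) (Localization.Away (X 0 : MvPolynomial (Fin 4) k)) (X 0) := by
  change lam₁' k (mkC k (X 3)) = _
  rw [lam₁'_mkC, MvPolynomial.eval₂Hom_X', lamVal₁'_3]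

/-- `λ₁'(x̄₁)` is a unit. [folklore] -/
theorem isUnit_lam₁'_tr_one : IsUnit (lam₁' k (tr₁ k 1)) := by
  rw [lam₁'_tr_one]
  exact IsLocalization.Away.algebraMap_isUnit (X 0 : MvPolynomial (Fin 4) k)

/-- **`Λ₁'`**, the left inverse of `ψ₁'` after localisation. OURS bookkeeping. -/
def Λ₁' : Localization.Away (tr₁ k 1) →+* Localization.Away (X 0 : MvPolynomial (Fin 4) k) :=
  IsLocalization.Away.lift (tr₁ k 1) (isUnit_lam₁'_tr_one k)

/-- `Λ₁'` extends `λ₁'`. [folklore] -/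
theorem Λ₁'_algebraMap (y : OC k) : Λ₁' k (algebraMap (OC k) (Localization.Away (tr₁ k 1)) y) = lam₁' k y :=
  IsLocalization.Away.lift_eq (tr₁ k 1) (isUnit_lam₁'_tr_one k) y

/-- `Λ₁'` on a fraction. [folklore] -/
theorem Λ₁'_frac {r : OC k} {t : Localization.Away (X 0 : MvPolynomial (Fin 4) k)} (h : lam₁' k r = t * lam₁' k (tr₁ k 1)) :
    Λ₁' k (algebraMap (OC k) (Localization.Away (tr₁ k 1)) r * IsLocalization.Away.invSelf (tr₁ k 1)) = t := by
  refine (isUnit_lam₁'_tr_one k).mul_left_injective ?_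
  dsimp only
  rw [← h, ← Λ₁'_algebraMap k (tr₁ k 1), ← map_mul, mul_assoc, mul_comm (IsLocalization.Away.invSelf (tr₁ k 1)),
    x₁_mul_invSelf, mul_one, Λ₁'_algebraMap]

/-- **`Λ₁' ∘ ψ₁' = (k[x₁,y₂,d,s] → k[x₁,y₂,d,s][1/x₁])`.** [folklore] -/
theorem Λ₁'_comp_ψ₁' :
    (Λ₁' k).comp (((B₁' k).val : B₁' k →+* Localization.Away (tr₁ k 1)).comp (ψ₁' k)) =
      algebraMap (MvPolynomial (Fin 4) k) (Localization.Away (X 0 : MvPolynomial (Fin 4) k)) := by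
  refine MvPolynomial.ringHom_ext (fun a => ?_) (fun j => ?_)
  · rw [RingHom.comp_apply, RingHom.comp_apply, ψ₁'_C]
    change Λ₁' k (algebraMap (OC k) (Localization.Away (tr₁ k 1)) (mkC k (C a))) = _
    rw [Λ₁'_algebraMap, lam₁'_mkC, MvPolynomial.eval₂Hom_C]
  · rw [RingHom.comp_apply, RingHom.comp_apply]
    match j with
    | ⟨0, _⟩ =>
      change Λ₁' k ((ψ₁' k (X 0) : B₁' k) : Localization.Away (tr₁ k 1)) = algebraMap _ _ (X 0)
      rw [ψ₁'_X₀]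
      change Λ₁' k (algebraMap (OC k) (Localization.Away (tr₁ k 1)) (mkC k (X 3))) = _
      rw [Λ₁'_algebraMap, lam₁'_mkC, MvPolynomial.eval₂Hom_X']
      rfl
    | ⟨1, _⟩ =>
      change Λ₁' k ((ψ₁' k (X 1) : B₁' k) : Localization.Away (tr₁ k 1)) = algebraMap _ _ (X 1)
      rw [ψ₁'_X₁]
      change Λ₁' k (algebraMap (OC k) (Localization.Away (tr₁ k 1)) (mkC k (X 4))) = _
      rw [Λ₁'_algebraMap, lam₁'_mkC, MvPolynomial.eval₂Hom_X']
      rfl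
    | ⟨2, _⟩ =>
      change Λ₁' k ((ψ₁' k (X 2) : B₁' k) : Localization.Away (tr₁ k 1)) = algebraMap _ _ (X 2)
      rw [ψ₁'_X₂]
      change Λ₁' k (algebraMap (OC k) (Localization.Away (tr₁ k 1)) (mkC k (X 5))) = _
      rw [Λ₁'_algebraMap, lam₁'_mkC, MvPolynomial.eval₂Hom_X']
      rfl
    | ⟨3, _⟩ =>
      change Λ₁' k ((ψ₁' k (X 3) : B₁' k) : Localization.Away (tr₁ k 1)) = algebraMap _ _ (X 3)
      rw [ψ₁'_X₃, blowupAlgebra.coe_frac]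
      refine Λ₁'_frac k ?_
      change lam₁' k (mkC k (X 0)) = _
      rw [lam₁'_tr_one, lam₁'_mkC, MvPolynomial.eval₂Hom_X', ← map_mul, lamVal₁'_0, mul_comm]

/-- **`ψ₁'` is injective** (`k` a domain). [folklore] -/
theorem ψ₁'_injective [IsDomain k] : Function.Injective (ψ₁' k) := by
  have hinj : Function.Injective
      (algebraMap (MvPolynomial (Fin 4) k) (Localization.Away (X 0 : MvPolynomial (Fin 4) k))) :=
    IsLocalization.injective _ (powers_le_nonZeroDivisors_of_noZeroDivisors (MvPolynomial.X_ne_zero 0))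
  rw [← Λ₁'_comp_ψ₁', RingHom.coe_comp, RingHom.coe_comp] at hinj
  exact hinj.of_comp.of_comp

/-- **RIBBON EXIT, chart `x₁`: `ψ₁' : k[x₁, y₂, d, s] → 𝒪_𝒞[(x̄₃,x̄₁)/x̄₁]` is a bijection** (graph `c̄ = −ȳ₂s`, `ȳ₁ = d̄s`). OURS. -/
theorem ψ₁'_bijective [IsDomain k] : Function.Bijective (ψ₁' k) :=
  ⟨ψ₁'_injective k, ψ₁'_surjective k⟩

/-- **The chart `𝒪_𝒞[(x̄₃,x̄₁)/x̄₁]` is a regular ring** (over a field). OURS. -/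
theorem isRegularRing_B₁' (K : Type u) [Field K] : IsRegularRing (B₁' K) :=
  IsRegularRing.of_ringEquiv (RingEquiv.ofBijective (ψ₁' K) (ψ₁'_bijective K))

/-- **RIBBON EXIT, both charts (N6.1 (c) model form): the blow-up of the vertex `𝒞` along the reduced trace `(x̄₃, x̄₁)` of the ribbon centres
`Z_m` — the second small resolution — is REGULAR on every chart.** OURS. -/
theorem isRegularRing_ribbonChart (K : Type u) [Field K] (i : Fin 2) :
    IsRegularRing (blowupAlgebra (Ideal.span (Set.range (tr₁ K))) (tr₁ K i)) := by
  match i with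
  | ⟨0, _⟩ => exact isRegularRing_B₁ K
  | ⟨1, _⟩ => exact isRegularRing_B₁' K

end VertexExit

end Summit.ResolutionOfSingularities.ResolutionOfSingularities.Cruxes.EquisingularLiftNat.Sections
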